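import Summits.CriticalPhenomena.CardyFormulaZ2.Theorems.CardyComplexConeParafermionToSLESixFamiliesDiamondDefs
import Literature.Probability.RandomPlanarGeometry.MarkedDomainCorners
import Literature.Probability.LatticeModels.BoundaryValues
import Literature.Probability.Percolation.QuadCrossingPathCrossings
import HarnessLib

/-!
# The discrete arcs of an admissible family in the bulk of a boundary segment
# (line `potential-darboux-picard-diamond`, S1′: lattice input for (DIR)/(LOW))

Crux `ParafermionToSLESixFamilies` (stmt-CriticalPhenomena-11389), line `potential-darboux-picard-diamond`, stub
`stub_exactPotentialTracePh` (S1′). Clauses (DIR)/(LOW) read the exact potential along the side cells of a boundary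
segment `[p, q]` (`IsBdrySegment D p q`), `η`-trimmed at both ends. On the lattice this needs to know, eventually in the
mesh `δ` of an admissible family `IsFamily D Λ`, which discrete arc the boundary sites near `[p, q]` belong to. The
arcs of `Λ δ` are CUT OUT OF THE DISCRETE BOUNDARY BY A DISTANCE COMPARISON with the (arbitrary) sets `(Λ δ).arcA`,
`(Λ δ).arcB`, which only converge in Hausdorff distance to `D.arc 0`, `D.arc 1`; this file proves that the comparison is
nevertheless forced in the bulk of a segment:

* `not_mem_zdDiscreteArc_of_far` — the metric core: a lattice site whose mesh point is within `d` of a frontier point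
  `z` cannot be on the discrete arc cut out by a nonempty set `S` lying within `ε` of a set `K` with
  `infDist z K > ε + 2d`;
* `exists_pos_le_infDist_of_segment` — points of `[p, q]` at distance `≥ η` from both endpoints are at distance `≥ c > 0`
  from a closed set meeting `[p, q]` at most in `{p, q}` (compactness);
* `eventually_forall_infDist_le_of_tendsto` — Hausdorff convergence read pointwise;
* **`eventually_arcs_near_freeSegment`** (registered, `--supports` the crux) — for ANY Dobrushin domain and admissible
  family, an oriented boundary segment `[p, q] ⊆ D.arc 1` (the free arc) and `η > 0`: for all small `δ`, every lattice
  site within `6δ` of `[p, q]` and at distance `≥ η` from `p` and `q` is OFF the wired discrete arc, and ON the dual-wired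
  one as soon as it is a discrete boundary site; `eventually_arcs_near_wiredSegment` — the same with the roles of the
  arcs exchanged for `[p, q] ⊆ D.arc 0`.

No property of diamonds is used: the statements hold for every Dobrushin (Jordan) domain.
-/

noncomputable section

namespace Summit.CriticalPhenomena.CardyFormulaZ2.Cruxes.ParafermionToSLESixFamilies.PotentialDarbouxPicardDiamond

open scoped Topology NNReal ENNReal
open Filter Set Metric Complex
open Literature.Probability Literature.Probability.LatticeModels Literature.Probability.Percolation
open Literature.Probability.LatticeModels.DiscreteDobrushin
open Literature.Probability.RandomPlanarGeometry
open Summit.CriticalPhenomena.CardyFormulaZ2.Cruxes.ParafermionToSLESixFamilies.IicTraceFluxPairing (IsFamily)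

/-! ## The metric core -/

/-- **Arc exclusion.** Let `S` be a nonempty set within `ε` of `K` (`infDist s K ≤ ε` for `s ∈ S`), `z` a frontier
point of `E.Ω` with `infDist z K > ε + 2 d`, and `x` a lattice site with `dist (δx) z ≤ d`. Then `x` is not on the
discrete arc of `E` cut out by `S`: `z ∉ S`, so the distance of `δx` to `frontier E.Ω \ S` is at most `d`, while every
point of `S` is farther than `d` from `δx`. -/
theorem not_mem_zdDiscreteArc_of_far {E : DiscreteDobrushin} {S K : Set ℂ} {x : Site 2} {z : ℂ} {ε d : ℝ}
    (hS : ∀ s ∈ S, infDist s K ≤ ε) (hSne : S.Nonempty) (hz : z ∈ frontier E.Ω)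
    (hxz : dist (meshPoint E.δ x) z ≤ d) (hfar : ε + 2 * d < infDist z K) : x ∉ E.zdDiscreteArc S := by
  intro hx
  rw [mem_zdDiscreteArc_iff] at hx
  have hzS : z ∉ S := fun hzS => by
    have h1 := hS z hzS
    have h2 : 0 ≤ dist (meshPoint E.δ x) z := dist_nonneg
    have h3 : infDist z K ≤ ε := h1
    linarith
  -- the complement side is close
  have hzm : z ∈ frontier E.Ω \ S := ⟨hz, hzS⟩
  have hR : infDist (meshPoint E.δ x) (frontier E.Ω \ S) ≤ d :=
    (infDist_le_dist_of_mem hzm).trans hxz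
  -- the arc side is far
  have hL : infDist z K - ε - d ≤ infDist (meshPoint E.δ x) S := by
    rw [le_infDist hSne]
    intro s hs
    have h1 : infDist z K ≤ infDist s K + dist z s := infDist_le_infDist_add_dist
    have h2 : dist z s ≤ dist z (meshPoint E.δ x) + dist (meshPoint E.δ x) s := dist_triangle _ _ _
    rw [dist_comm z (meshPoint E.δ x)] at h2
    linarith [hS s hs]
  linarith [hx.2]

/-! ## Compactness: the bulk of a segment is far from the other arc -/

/-- **The bulk of a segment is uniformly far from a closed set meeting it at most in its endpoints.** -/
theorem exists_pos_le_infDist_of_segment {K : Set ℂ} (hK : IsClosed K) (hKne : K.Nonempty) {p q : ℂ}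
    (hmeet : ∀ z ∈ segment ℝ p q, z ∈ K → z = p ∨ z = q) {η : ℝ} (hη : 0 < η) :
    ∃ c : ℝ, 0 < c ∧ ∀ z ∈ segment ℝ p q, η ≤ dist z p → η ≤ dist z q → c ≤ infDist z K := by
  set B : Set ℂ := {z ∈ segment ℝ p q | η ≤ dist z p ∧ η ≤ dist z q} with hB
  have hBc : IsCompact B := by
    refine (isCompact_segment_complex p q).of_isClosed_subset ?_ (fun z hz => hz.1)
    refine (isCompact_segment_complex p q).isClosed.inter ?_
    exact (isClosed_le continuous_const (continuous_id.dist continuous_const)).inter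
      (isClosed_le continuous_const (continuous_id.dist continuous_const))
  rcases B.eq_empty_or_nonempty with hBe | hBne
  · refine ⟨1, one_pos, fun z hz hp hq => ?_⟩
    have : z ∈ B := ⟨hz, hp, hq⟩
    rw [hBe] at this
    exact this.elim
  · obtain ⟨z₀, hz₀, hmin⟩ := hBc.exists_isMinOn hBne (continuous_infDist_pt K).continuousOn
    have hpos : 0 < infDist z₀ K := by
      rw [← hK.notMem_iff_infDist_pos hKne]
      intro hzK
      rcases hmeet z₀ hz₀.1 hzK with rfl | rfl
      · have := hz₀.2.1; rw [dist_self] at this; linarith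
      · have := hz₀.2.2; rw [dist_self] at this; linarith
    exact ⟨infDist z₀ K, hpos, fun z hz hp hq => hmin ⟨hz, hp, hq⟩⟩

/-! ## Hausdorff convergence, pointwise -/

/-- **Hausdorff convergence read pointwise**: if `hausdorffEDist (S δ) K → 0`, then for every `ε > 0`, eventually
every point of `S δ` is within `ε` of `K`. -/
theorem eventually_forall_infDist_le_of_tendsto {S : ℝ → Set ℂ} {K : Set ℂ} {l : Filter ℝ}
    (h : Tendsto (fun δ => hausdorffEDist (S δ) K) l (𝓝 0)) {ε : ℝ} (hε : 0 < ε) :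
    ∀ᶠ δ in l, ∀ s ∈ S δ, infDist s K ≤ ε := by
  filter_upwards [h.eventually_lt_const (ENNReal.ofReal_pos.2 hε)] with δ hδ s hs
  obtain ⟨k, hk, hsk⟩ := exists_edist_lt_of_hausdorffEDist_lt hs hδ
  rw [edist_lt_ofReal] at hsk
  exact (infDist_le_dist_of_mem hk).trans hsk.le

/-! ## The arcs in the bulk of a boundary segment -/

/-- **The core, along a family.** For a family with `(Λ δ).Ω = D.carrier`, mesh `δ`, sets `S δ` converging to a closed
nonempty `K` in Hausdorff distance and eventually nonempty, and a segment `[p, q] ⊆ frontier D` meeting `K` at most in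
`{p, q}`: for all small `δ`, every lattice site within `6δ` of `[p, q]` and at distance `≥ η` from `p, q` is off the
discrete arc of `Λ δ` cut out by `S δ`. -/
theorem eventually_not_mem_zdDiscreteArc (D : DobrushinDomain) (Λ : ℝ → DiscreteDobrushin)
    (hΩ : ∀ δ, (Λ δ).Ω = D.carrier) (hmesh : ∀ δ, (Λ δ).δ = δ) (S : ℝ → Set ℂ) {K : Set ℂ} (hK : IsClosed K)
    (hKne : K.Nonempty) (hS : Tendsto (fun δ => hausdorffEDist (S δ) K) (𝓝[>] (0:ℝ)) (𝓝 0))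
    (hSne : ∀ᶠ δ in 𝓝[>] (0:ℝ), (S δ).Nonempty) {p q : ℂ} (hpq : segment ℝ p q ⊆ frontier D.carrier)
    (hmeet : ∀ z ∈ segment ℝ p q, z ∈ K → z = p ∨ z = q) {η : ℝ} (hη : 0 < η) :
    ∀ᶠ δ in 𝓝[>] (0:ℝ), ∀ x : Site 2, infDist (meshPoint δ x) (segment ℝ p q) ≤ 6 * δ →
      η ≤ dist (meshPoint δ x) p → η ≤ dist (meshPoint δ x) q → x ∉ (Λ δ).zdDiscreteArc (S δ) := by
  obtain ⟨c, hc, hfar⟩ := exists_pos_le_infDist_of_segment hK hKne hmeet (half_pos hη)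
  have hsmall : ∀ᶠ δ in 𝓝[>] (0:ℝ), 0 < δ ∧ δ < min (c / 16) (η / 12) := by
    filter_upwards [Ioo_mem_nhdsGT (lt_min (by positivity) (by positivity) : (0:ℝ) < min (c / 16) (η / 12))]
      with δ hδ using hδ
  filter_upwards [eventually_forall_infDist_le_of_tendsto hS (by positivity : 0 < c / 4), hSne, hsmall]
    with δ hHS hne hδ x hx hp hq
  obtain ⟨hδ0, hδ1⟩ := hδ
  have hδc : δ < c / 16 := lt_of_lt_of_le hδ1 (min_le_left _ _)
  have hδη : δ < η / 12 := lt_of_lt_of_le hδ1 (min_le_right _ _)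
  -- the nearest point of the segment
  have hsegne : (segment ℝ p q).Nonempty := ⟨p, left_mem_segment ℝ p q⟩
  obtain ⟨z, hz, hzd⟩ := (isCompact_segment_complex p q).exists_infDist_eq_dist hsegne (meshPoint δ x)
  have hxz : dist (meshPoint δ x) z ≤ 6 * δ := hzd ▸ hx
  have hzp : η / 2 ≤ dist z p := by
    have := dist_triangle (meshPoint δ x) z p
    linarith
  have hzq : η / 2 ≤ dist z q := by
    have := dist_triangle (meshPoint δ x) z q
    linarith
  have hzK := hfar z hz hzp hzq
  refine not_mem_zdDiscreteArc_of_far (E := Λ δ) (z := z) (ε := c / 4) (d := 6 * δ) hHS hne ?_ ?_ ?_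
  · rw [hΩ]; exact hpq hz
  · rw [hmesh]; exact hxz
  · linarith

variable {D : DobrushinDomain} {Λ : ℝ → DiscreteDobrushin}

/-- On `[p, q] ⊆ D.arc 1` with no mark in the open segment, `D.arc 0` meets `[p, q]` at most in `{p, q}`. -/
theorem meet_of_subset_arc {p q : ℂ} {i : Fin 2} (hsub : segment ℝ p q ⊆ D.arc i)
    (h0 : D.pt 0 ∉ openSegment ℝ p q) (h1 : D.pt 1 ∉ openSegment ℝ p q) :
    ∀ z ∈ segment ℝ p q, z ∈ D.arc (i + 1) → z = p ∨ z = q := by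
  intro z hz hzi
  have hne : i ≠ i + 1 := by fin_cases i <;> decide
  have hmark : z = D.pt (i + 1) ∨ z = D.pt (i + 1 + 1) := D.mem_arc_inter_arc hne hzi (hsub hz)
  have hz' : z ∈ insert p (insert q (openSegment ℝ p q)) := by rwa [insert_endpoints_openSegment]
  rcases hz' with rfl | rfl | hzo
  · exact Or.inl rfl
  · exact Or.inr rfl
  · exfalso
    have h11 : (1 : Fin 2) + 1 = 0 := rfl
    rcases hmark with rfl | rfl <;> fin_cases i
    · exact h1 hzo
    · simp only [Fin.mk_one, h11] at hzo; exact h0 hzo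
    · simp only [Fin.zero_eta, zero_add, h11] at hzo; exact h0 hzo
    · simp only [Fin.mk_one, h11, zero_add] at hzo; exact h1 hzo

/-- **The arcs near a free boundary segment** (registered helper of `stub_exactPotentialTracePh`). For every Dobrushin
domain `D`, admissible family `Λ`, oriented boundary segment `[p, q]` contained in the free arc `D.arc 1`, and `η > 0`:
for all small `δ`, every lattice site whose mesh point is within `6δ` of `[p, q]` and at distance `≥ η` from `p` and from
`q` is off the wired discrete arc of `Λ δ`, and on the dual-wired one if it is a discrete boundary site. -/
theorem eventually_arcs_near_freeSegment : ∀ (D : DobrushinDomain) (Λ : ℝ → DiscreteDobrushin), IsFamily D Λ → ∀ p q : ℂ, IsBdrySegment D p q → segment ℝ p q ⊆ D.arc 1 → ∀ η : ℝ, 0 < η → ∀ᶠ δ in 𝓝[>] (0:ℝ), ∀ x : Site 2, infDist (meshPoint δ x) (segment ℝ p q) ≤ 6 * δ → η ≤ dist (meshPoint δ x) p → η ≤ dist (meshPoint δ x) q → x ∉ (Λ δ).zdArcA ∧ (x ∈ (Λ δ).zdBoundary → x ∈ (Λ δ).zdArcB) := by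
  intro D Λ hΛ p q hpq hsub η hη
  obtain ⟨hΩ, hmesh, hA, -, -, hadm⟩ := hΛ
  obtain ⟨-, hfr, h0, h1, -⟩ := hpq
  have hmeet : ∀ z ∈ segment ℝ p q, z ∈ D.arc 0 → z = p ∨ z = q := by
    have := meet_of_subset_arc (i := 1) hsub h0 h1
    simpa using this
  have hSne : ∀ᶠ δ in 𝓝[>] (0:ℝ), ((Λ δ).arcA).Nonempty := by
    filter_upwards [hadm] with δ hδ using hδ.arcA_nonempty
  filter_upwards [eventually_not_mem_zdDiscreteArc D Λ hΩ hmesh (fun δ => (Λ δ).arcA) (D.isClosed_arc 0)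
    ⟨_, D.pt_mem_arc_self 0⟩ hA hSne hfr hmeet hη, hadm] with δ hδ hadmδ x hx hp hq
  have hnot : x ∉ (Λ δ).zdArcA := hδ x hx hp hq
  exact ⟨hnot, fun hb => (hadmδ.zdBoundary_subset hb).resolve_left hnot⟩

/-- **The arcs near a wired boundary segment**: the same with `[p, q] ⊆ D.arc 0` and the roles of the arcs exchanged. -/
theorem eventually_arcs_near_wiredSegment (hΛ : IsFamily D Λ) {p q : ℂ} (hpq : IsBdrySegment D p q)
    (hsub : segment ℝ p q ⊆ D.arc 0) {η : ℝ} (hη : 0 < η) :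
    ∀ᶠ δ in 𝓝[>] (0:ℝ), ∀ x : Site 2, infDist (meshPoint δ x) (segment ℝ p q) ≤ 6 * δ →
      η ≤ dist (meshPoint δ x) p → η ≤ dist (meshPoint δ x) q →
        x ∉ (Λ δ).zdArcB ∧ (x ∈ (Λ δ).zdBoundary → x ∈ (Λ δ).zdArcA) := by
  obtain ⟨hΩ, hmesh, -, hB, -, hadm⟩ := hΛ
  obtain ⟨-, hfr, h0, h1, -⟩ := hpq
  have hmeet : ∀ z ∈ segment ℝ p q, z ∈ D.arc 1 → z = p ∨ z = q := by
    have := meet_of_subset_arc (i := 0) hsub h0 h1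
    simpa using this
  have hSne : ∀ᶠ δ in 𝓝[>] (0:ℝ), ((Λ δ).arcB).Nonempty := by
    filter_upwards [hadm] with δ hδ using hδ.arcB_nonempty
  filter_upwards [eventually_not_mem_zdDiscreteArc D Λ hΩ hmesh (fun δ => (Λ δ).arcB) (D.isClosed_arc 1)
    ⟨_, D.pt_mem_arc_self 1⟩ hB hSne hfr hmeet hη, hadm] with δ hδ hadmδ x hx hp hq
  have hnot : x ∉ (Λ δ).zdArcB := hδ x hx hp hq
  exact ⟨hnot, fun hb => (hadmδ.zdBoundary_subset hb).resolve_right hnot⟩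

end Summit.CriticalPhenomena.CardyFormulaZ2.Cruxes.ParafermionToSLESixFamilies.PotentialDarbouxPicardDiamond

end
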